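import Summits.QuantumFields.YangMills.Theorems.FluctuationComparisonRegPrIntLOrganTangentSigmaVersionChartMean
import Summits.QuantumFields.YangMills.Theorems.FluctuationComparisonRegPrIntLRunpairOrganFibreLawDefs
import HarnessLib

/-!
# Route `UnitScaleTilt` — crux `FluctuationComparisonRegPrIntL` (stmt-QuantumFields-20520, rung R3), PATH-B organ: THE INTERPOLATED FIBRE LAW IS A LAW —
# `wNum_t` is integrable with positive mass and `wgt_t` integrates to one, at EVERY window point and EVERY `t` (the (JV0-h) normalisation conjunct of `SpreadFibreLawHJ`, DISCHARGED)

Cell `ym3-torus` (rung R3 = continuum `SU(2)` Yang–Mills on T³ — NOT d = 4, NOT infinite volume, NOT a mass gap, NOT Clay).  LEAD-20520 width seat `ym-ust-20520-w3` g26;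
def-free, `--supports stmt-QuantumFields-20520 --as helper`, default heartbeats, `autoImplicit false`.

WHAT.  For the reviewed fibre-weight letters `wNum`∕`wgt` of ✓`…RunpairOrganFibreLawDefs` (✓p812742): given the frame's level-`Ts` densities `ρ ρ′` (measurable; continuous
and positive on the `θ_Ts`-window), the multi-window cut `mwCut` (continuous, `≥ 0`, supported in the MW-good set and positive there — ✓`exists_height_multiWindowWeight`),
and a fibred chart's data `(τ, Φ, J)` with `τ` a probability measure, `Φ J` measurable, `J ≤ CJ` ([8]) and positive good-set mass ([9]) — THEN for EVERY real `t` and every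
window point `V` (`PlaqSmall θ_j V`): `z ↦ wNum_t(V, z)` is `τ`-integrable with `0 < ∫ wNum_t(V,·) dτ`, and `z ↦ wgt_t(V,z) = wNum_t(V,z) ∕ ∫ wNum_t(V,·)` is integrable with
`∫ wgt_t(V,·) dτ = 1` (`wgt_normalised`); Appendix v1.1 (append-only): `wNum_nonneg`, `wgt_nonneg` — the weights are pointwise `≥ 0`
at every coarse field (the `0 ≤ ŵ` hypothesis of ✓TS ∕ JT-INT).  This is the LAW-NORMALISATION half of the (JV0-h) conjunct of the frozen Jensen row `SpreadFibreLawHJ` (✓p814004; LEAD DESIGN CALL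
№33 R3), discharged from the row's own chart block and the organ frame — the discharger of `SpreadFibreLawHJ` cites it by name; the other half of (JV0-h) (integrability of
`h_Ts∘Φ(X,·)` and its square against `ŵ_t(Xw)`) is SQUARE STABILITY and stays the discharger's.  Mechanism (= ✓`…SigmaVersionChartMean`'s, at general `t`): the
`24∕25`-closed plaquette window is compact inside the open `θ_Ts`-window, so `χ·ρ^t·ρ′^{1−t}` pastes to a continuous, hence bounded, function (✓`continuous_mul_of_support`,
✓`exists_abs_le_of_continuous`); times `J ≤ CJ` it is integrable on the probability space; it is `≥ 0` and `> 0` on the MW-good set, whose `J`-mass is positive by [9], so the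
mass is positive (`integral_pos_iff_support_of_nonneg`); `wgt = wNum ∕ mass`.

HONEST FRAMING: measure-theory bookkeeping ([folklore]); nothing of Bałaban's analysis is asserted or proved; `SpreadFibreLawH(J)` remain HYPOTHESIS rows (their (H)∕(HV′)
brackets and the square-stability half of (JV0-h) untouched); JVAR″, JEN″, LIN″, O1ᵘ-H v2.2, S1aᴴ, S3ᴴ, S2α′, S2β, 26243, the five registered stubs of
`Lines/semiclassical_s2beta.lean`, crux 20520 and `YM3TorusSU2` are NOT proved; rung R3 = SU(2) YM₃ on T³ at fixed lattice data — NOT d = 4, NOT infinite volume, NOT a mass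
gap, NOT Clay; the Yang–Mills mass gap is NOT proved.
-/

set_option autoImplicit false

noncomputable section

namespace Summit.QuantumFields.YangMills.Theorems.OrganTangentFibreWeightNormalisation

open MeasureTheory Filter Topology
open scoped ENNReal NNReal
open Literature.MathematicalPhysics.QuantumFieldTheory.Balaban1983to89 T3ContinuumYM3Torus T3NestedUnitLaws
  T3UnitLawDensityEML T4Continuum T3UnitScaleTilt T3LevelShift T3TiltDescent
open Summit.QuantumFields.YangMills.BalabanUVNodes.N09DomAltThresholdNull (isOpen_setOf_plaqSmall_SU)
open Literature.MathematicalPhysics.QuantumFieldTheory.Balaban1983to89.B12ContinuousTransportInvarianceOn (continuous_dist1_SU continuous_plaqHol_SU)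
open Summit.QuantumFields.YangMills.Theorems.OrganTangentSigmaVersionChartMean (continuous_mul_of_support exists_abs_le_of_continuous)
open Summit.QuantumFields.YangMills.Theorems.FluctuationComparisonRegPrIntLRunpairOrganFibreLaw (mwCut wNum wgt)

/-- ★★ **THE INTERPOLATED FIBRE WEIGHT IS A NORMALISABLE LAW** — for every real `t` and every window point `V`: `wNum_t(V,·)` is `τ`-integrable with positive mass, and
`wgt_t(V,·)` is integrable with `∫ wgt_t(V,·) dτ = 1` (the law-normalisation half of `SpreadFibreLawHJ`'s (JV0-h), from the chart block [8]–[9] and the frame; see the module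
docstring). [folklore] -/
theorem wgt_normalised (F : T3Family) (γ b₀ p₀ : ℝ) (j Ts : ℕ) (hjTs : j + 1 ≤ Ts)
    (ρ ρ' : (i : ℕ) → GaugeField (F.P i) 0 ↥(Matrix.specialUnitaryGroup (Fin 2) ℂ) → ℝ)
    (hρm : Measurable (ρ Ts)) (hρ'm : Measurable (ρ' Ts))
    (hρc : ContinuousOn (ρ Ts) {U | PlaqSmall (θBal F.L γ b₀ p₀ Ts) U}) (hρ'c : ContinuousOn (ρ' Ts) {U | PlaqSmall (θBal F.L γ b₀ p₀ Ts) U})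
    (hρpos : ∀ U, PlaqSmall (θBal F.L γ b₀ p₀ Ts) U → 0 < ρ Ts U ∧ 0 < ρ' Ts U)
    (hθ : 0 < θBal F.L γ b₀ p₀ Ts)
    (hχc : Continuous (mwCut F γ b₀ p₀ j Ts)) (hχ0 : ∀ U, 0 ≤ mwCut F γ b₀ p₀ j Ts U)
    (hχsupp : ∀ U, mwCut F γ b₀ p₀ j Ts U ≠ 0 → ∀ (n : ℕ) (hjn : j + 1 ≤ n) (hnK : n ≤ Ts), PlaqSmall (24 / 25 * θBal F.L γ b₀ p₀ n) (descendTo F ℰp n Ts hnK U))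
    (hχpos : ∀ U, (∀ (n : ℕ) (hjn : j + 1 ≤ n) (hnK : n ≤ Ts), PlaqSmall (24 / 25 * θBal F.L γ b₀ p₀ n) (descendTo F ℰp n Ts hnK U)) → 0 < mwCut F γ b₀ p₀ j Ts U)
    {Z : Type} [MeasurableSpace Z] (τ : Measure Z) [IsProbabilityMeasure τ]
    (Φ : GaugeField (F.P j) 0 ↥(Matrix.specialUnitaryGroup (Fin 2) ℂ) × Z → GaugeField (F.P Ts) 0 ↥(Matrix.specialUnitaryGroup (Fin 2) ℂ))
    (J : GaugeField (F.P j) 0 ↥(Matrix.specialUnitaryGroup (Fin 2) ℂ) × Z → ℝ≥0)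
    (hΦm : Measurable Φ) (hJm : Measurable J) (CJ : ℝ) (hJle : ∀ V z, (J (V, z) : ℝ) ≤ CJ)
    (hpos : ∀ V, PlaqSmall (θBal F.L γ b₀ p₀ j) V →
      0 < ∫⁻ z in {z | (∀ (n : ℕ) (hjn : j + 1 ≤ n) (hnK : n ≤ Ts), PlaqSmall (24 / 25 * θBal F.L γ b₀ p₀ n) (descendTo F ℰp n Ts hnK (Φ (V, z))))},
        (J (V, z) : ℝ≥0∞) ∂τ) :
    ∀ (t : ℝ) (V : GaugeField (F.P j) 0 ↥(Matrix.specialUnitaryGroup (Fin 2) ℂ)), PlaqSmall (θBal F.L γ b₀ p₀ j) V →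
      Integrable (fun z => wNum F γ b₀ p₀ j Ts ρ ρ' Φ J t V z) τ ∧ 0 < ∫ z, wNum F γ b₀ p₀ j Ts ρ ρ' Φ J t V z ∂τ ∧
      Integrable (fun z => wgt F γ b₀ p₀ j Ts ρ ρ' τ Φ J t V z) τ ∧ ∫ z, wgt F γ b₀ p₀ j Ts ρ ρ' τ Φ J t V z ∂τ = 1 := by
  classical
  intro t V hV
  haveI : CompactSpace (GaugeField (F.P Ts) 0 ↥(Matrix.specialUnitaryGroup (Fin 2) ℂ)) :=
    inferInstanceAs (CompactSpace (PBond (F.P Ts) 0 → ↥(Matrix.specialUnitaryGroup (Fin 2) ℂ)))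
  haveI : BorelSpace (GaugeField (F.P Ts) 0 ↥(Matrix.specialUnitaryGroup (Fin 2) ℂ)) :=
    Literature.MathematicalPhysics.QuantumFieldTheory.Balaban1983to89.T3OrbitAverage.instBorelSpaceGaugeField
  set MW : GaugeField (F.P Ts) 0 ↥(Matrix.specialUnitaryGroup (Fin 2) ℂ) → Prop := fun U =>
    ∀ (n : ℕ) (hjn : j + 1 ≤ n) (hnK : n ≤ Ts), PlaqSmall (24 / 25 * θBal F.L γ b₀ p₀ n) (descendTo F ℰp n Ts hnK U) with hMW
  set χ : GaugeField (F.P Ts) 0 ↥(Matrix.specialUnitaryGroup (Fin 2) ℂ) → ℝ := mwCut F γ b₀ p₀ j Ts with hχ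
  set g : GaugeField (F.P Ts) 0 ↥(Matrix.specialUnitaryGroup (Fin 2) ℂ) → ℝ := fun U => ρ Ts U ^ t * ρ' Ts U ^ (1 - t) with hg
  set f : GaugeField (F.P Ts) 0 ↥(Matrix.specialUnitaryGroup (Fin 2) ℂ) → ℝ := fun U => χ U * g U with hf
  -- the weight numerator is `f(Φ(V,z))·J(V,z)`
  have hwNum : ∀ z, wNum F γ b₀ p₀ j Ts ρ ρ' Φ J t V z = f (Φ (V, z)) * (J (V, z) : ℝ) := by
    intro z
    simp only [hf, hg, hχ, wNum, Real.rpow_eq_pow]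
  -- the `24∕25`-closed window is compact inside the open `θ_Ts`-window and carries `supp χ`
  have hMWtop : ∀ U, MW U → PlaqSmall (24 / 25 * θBal F.L γ b₀ p₀ Ts) U := by
    intro U hU
    have := hU Ts hjTs le_rfl
    rwa [T3DescentFibreTower.descendTo_self] at this
  set C : Set (GaugeField (F.P Ts) 0 ↥(Matrix.specialUnitaryGroup (Fin 2) ℂ)) :=
    {U | ∀ p, dist1 (GaugeField.plaqHol U p) ≤ 24 / 25 * θBal F.L γ b₀ p₀ Ts} with hC
  have hCclosed : IsClosed C := by
    have : C = ⋂ p, {U | dist1 (GaugeField.plaqHol U p) ≤ 24 / 25 * θBal F.L γ b₀ p₀ Ts} := by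
      ext U; simp only [hC, Set.mem_setOf_eq, Set.mem_iInter]
    rw [this]
    exact isClosed_iInter fun p => isClosed_le ((continuous_dist1_SU (N := 2)).comp (continuous_plaqHol_SU (N := 2) p)) continuous_const
  have hO : IsOpen {U : GaugeField (F.P Ts) 0 ↥(Matrix.specialUnitaryGroup (Fin 2) ℂ) | PlaqSmall (θBal F.L γ b₀ p₀ Ts) U} :=
    isOpen_setOf_plaqSmall_SU 2 _ _ _
  have hCO : C ⊆ {U | PlaqSmall (θBal F.L γ b₀ p₀ Ts) U} := by
    intro U hU p
    exact lt_of_le_of_lt (hU p) (by linarith)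
  have hχC : ∀ U, χ U ≠ 0 → U ∈ C := fun U hU p => le_of_lt (hMWtop U (hχsupp U hU) p)
  -- continuity, measurability, boundedness, sign of `f`
  have hgc : ContinuousOn g {U | PlaqSmall (θBal F.L γ b₀ p₀ Ts) U} := by
    refine ContinuousOn.mul ?_ ?_
    · exact hρc.rpow_const fun U hU => Or.inl (hρpos U hU).1.ne'
    · exact hρ'c.rpow_const fun U hU => Or.inl (hρpos U hU).2.ne'
  have hfc : Continuous f := continuous_mul_of_support hO hCclosed hCO hχc hχC hgc
  have hχm : Measurable χ := hχc.measurable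
  have hgm : Measurable g := (hρm.pow_const t).mul (hρ'm.pow_const (1 - t))
  have hfm : Measurable f := hχm.mul hgm
  obtain ⟨M, hM⟩ := exists_abs_le_of_continuous hfc
  have hfnn : ∀ U, 0 ≤ f U := by
    intro U
    by_cases hU : χ U = 0
    · simp only [hf, hU, zero_mul, le_refl]
    · have hW := hCO (hχC U hU)
      exact mul_nonneg (hχ0 U) (mul_nonneg (Real.rpow_nonneg (hρpos U hW).1.le _) (Real.rpow_nonneg (hρpos U hW).2.le _))
  have hfpos : ∀ U, MW U → 0 < f U := by
    intro U hU
    have hW : PlaqSmall (θBal F.L γ b₀ p₀ Ts) U := hCO (fun p => le_of_lt (hMWtop U hU p))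
    exact mul_pos (hχpos U hU) (mul_pos (Real.rpow_pos_of_pos (hρpos U hW).1 _) (Real.rpow_pos_of_pos (hρpos U hW).2 _))
  have hJm1 : Measurable fun z => (J (V, z) : ℝ) := (hJm.comp (measurable_const.prodMk measurable_id)).coe_nnreal_real
  have hΦm1 : Measurable fun z => Φ (V, z) := hΦm.comp (measurable_const.prodMk measurable_id)
  -- integrability of the numerator
  have hint : Integrable (fun z => f (Φ (V, z)) * (J (V, z) : ℝ)) τ := by
    refine Integrable.mono' (integrable_const (M * CJ)) ((hfm.comp hΦm1).mul hJm1).aestronglyMeasurable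
      (Eventually.of_forall fun z => ?_)
    rw [Real.norm_eq_abs, abs_mul, abs_of_nonneg (NNReal.coe_nonneg _)]
    have hM0 : 0 ≤ M := (abs_nonneg _).trans (hM (Φ (V, z)))
    exact mul_le_mul (hM _) (hJle V z) (NNReal.coe_nonneg _) hM0
  -- positivity of the mass
  have hMpos : 0 < ∫ z, f (Φ (V, z)) * (J (V, z) : ℝ) ∂τ := by
    have hnn : 0 ≤ fun z => f (Φ (V, z)) * (J (V, z) : ℝ) := fun z => mul_nonneg (hfnn _) (NNReal.coe_nonneg _)
    rw [integral_pos_iff_support_of_nonneg hnn hint]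
    have hMWm : MeasurableSet {z | MW (Φ (V, z))} := by
      have : {z | MW (Φ (V, z))} = ⋂ (n : ℕ), ⋂ (hjn : j + 1 ≤ n), ⋂ (hnK : n ≤ Ts),
          (fun z => descendTo F ℰp n Ts hnK (Φ (V, z))) ⁻¹' {W | PlaqSmall (24 / 25 * θBal F.L γ b₀ p₀ n) W} := by
        ext z; simp only [hMW, Set.mem_setOf_eq, Set.mem_iInter, Set.mem_preimage]
      rw [this]
      exact MeasurableSet.iInter fun n => MeasurableSet.iInter fun hjn => MeasurableSet.iInter fun hnK =>
        ((measurable_descendTo F ℰp measurableE_ℰp hnK).comp hΦm1) (measurableSet_plaqSmall _)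
    by_contra hle
    have hzero : τ (Function.support fun z => f (Φ (V, z)) * (J (V, z) : ℝ)) = 0 := le_antisymm (not_lt.1 hle) bot_le
    have hae0 : ∀ᵐ z ∂τ, f (Φ (V, z)) * (J (V, z) : ℝ) = 0 := ae_iff.2 hzero
    have hJ0 : ∀ᵐ z ∂(τ.restrict {z | MW (Φ (V, z))}), (J (V, z) : ℝ≥0∞) = 0 := by
      rw [ae_restrict_iff' hMWm]
      filter_upwards [hae0] with z hz hzMW
      have hfz : f (Φ (V, z)) ≠ 0 := (hfpos _ hzMW).ne'
      have hJr : (J (V, z) : ℝ) = 0 := by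
        rcases mul_eq_zero.1 hz with h | h
        · exact absurd h hfz
        · exact h
      have : J (V, z) = 0 := by exact_mod_cast hJr
      rw [this]; rfl
    have h0 : ∫⁻ z in {z | MW (Φ (V, z))}, (J (V, z) : ℝ≥0∞) ∂τ = 0 :=
      (lintegral_congr_ae hJ0).trans lintegral_zero
    exact (lt_irrefl (0 : ℝ≥0∞)) (h0 ▸ hpos V hV)
  -- assemble
  have e1 : (fun z => wNum F γ b₀ p₀ j Ts ρ ρ' Φ J t V z) = fun z => f (Φ (V, z)) * (J (V, z) : ℝ) := funext hwNum
  have hI : Integrable (fun z => wNum F γ b₀ p₀ j Ts ρ ρ' Φ J t V z) τ := by rw [e1]; exact hint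
  have hP : 0 < ∫ z, wNum F γ b₀ p₀ j Ts ρ ρ' Φ J t V z ∂τ := by rw [e1]; exact hMpos
  have e2 : (fun z => wgt F γ b₀ p₀ j Ts ρ ρ' τ Φ J t V z)
      = fun z => wNum F γ b₀ p₀ j Ts ρ ρ' Φ J t V z / ∫ z', wNum F γ b₀ p₀ j Ts ρ ρ' Φ J t V z' ∂τ := by
    funext z; rfl
  refine ⟨hI, hP, ?_, ?_⟩
  · rw [e2]; exact hI.div_const _
  · rw [e2, integral_div]
    exact div_self hP.ne'

/-! ## Appendix (v1.1, append-only): pointwise sign of the weights — the `0 ≤ ŵ` hypothesis of ✓`…SecondDiffIntegration` (JT-INT) and ✓TS -/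

/-- The weight numerator is pointwise `≥ 0` at EVERY coarse field and fibre point: `χ ≥ 0`, `J ≥ 0`, and where `χ(Φ(V,z)) ≠ 0` the field is in the top window, so both
densities are positive there (for any real `t`). [folklore] -/
theorem wNum_nonneg (F : T3Family) (γ b₀ p₀ : ℝ) (j Ts : ℕ) (hjTs : j + 1 ≤ Ts)
    (ρ ρ' : (i : ℕ) → GaugeField (F.P i) 0 ↥(Matrix.specialUnitaryGroup (Fin 2) ℂ) → ℝ)
    (hρpos : ∀ U, PlaqSmall (θBal F.L γ b₀ p₀ Ts) U → 0 < ρ Ts U ∧ 0 < ρ' Ts U)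
    (hθ : 0 < θBal F.L γ b₀ p₀ Ts)
    (hχ0 : ∀ U, 0 ≤ mwCut F γ b₀ p₀ j Ts U)
    (hχsupp : ∀ U, mwCut F γ b₀ p₀ j Ts U ≠ 0 → ∀ (n : ℕ) (hjn : j + 1 ≤ n) (hnK : n ≤ Ts), PlaqSmall (24 / 25 * θBal F.L γ b₀ p₀ n) (descendTo F ℰp n Ts hnK U))
    {Z : Type} (Φ : GaugeField (F.P j) 0 ↥(Matrix.specialUnitaryGroup (Fin 2) ℂ) × Z → GaugeField (F.P Ts) 0 ↥(Matrix.specialUnitaryGroup (Fin 2) ℂ))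
    (J : GaugeField (F.P j) 0 ↥(Matrix.specialUnitaryGroup (Fin 2) ℂ) × Z → ℝ≥0) :
    ∀ (t : ℝ) (V : GaugeField (F.P j) 0 ↥(Matrix.specialUnitaryGroup (Fin 2) ℂ)) (z : Z), 0 ≤ wNum F γ b₀ p₀ j Ts ρ ρ' Φ J t V z := by
  intro t V z
  have htop : ∀ U, mwCut F γ b₀ p₀ j Ts U ≠ 0 → PlaqSmall (θBal F.L γ b₀ p₀ Ts) U := by
    intro U hU p
    have h := hχsupp U hU Ts hjTs le_rfl p
    rw [T3DescentFibreTower.descendTo_self] at h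
    exact lt_trans h (by linarith)
  by_cases hχ : mwCut F γ b₀ p₀ j Ts (Φ (V, z)) = 0
  · simp only [wNum, hχ, zero_mul, le_refl]
  · have hW := htop _ hχ
    simp only [wNum, Real.rpow_eq_pow]
    exact mul_nonneg (mul_nonneg (hχ0 _) (mul_nonneg (Real.rpow_nonneg (hρpos _ hW).1.le _) (Real.rpow_nonneg (hρpos _ hW).2.le _)))
      (NNReal.coe_nonneg _)

/-- The normalised weight is pointwise `≥ 0` at EVERY coarse field (window or not: off the window the mass may vanish and `wgt = wNum ∕ 0 = 0`), for any real `t`. [folklore] -/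
theorem wgt_nonneg (F : T3Family) (γ b₀ p₀ : ℝ) (j Ts : ℕ) (hjTs : j + 1 ≤ Ts)
    (ρ ρ' : (i : ℕ) → GaugeField (F.P i) 0 ↥(Matrix.specialUnitaryGroup (Fin 2) ℂ) → ℝ)
    (hρpos : ∀ U, PlaqSmall (θBal F.L γ b₀ p₀ Ts) U → 0 < ρ Ts U ∧ 0 < ρ' Ts U)
    (hθ : 0 < θBal F.L γ b₀ p₀ Ts)
    (hχ0 : ∀ U, 0 ≤ mwCut F γ b₀ p₀ j Ts U)
    (hχsupp : ∀ U, mwCut F γ b₀ p₀ j Ts U ≠ 0 → ∀ (n : ℕ) (hjn : j + 1 ≤ n) (hnK : n ≤ Ts), PlaqSmall (24 / 25 * θBal F.L γ b₀ p₀ n) (descendTo F ℰp n Ts hnK U))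
    {Z : Type} [MeasurableSpace Z] (τ : Measure Z)
    (Φ : GaugeField (F.P j) 0 ↥(Matrix.specialUnitaryGroup (Fin 2) ℂ) × Z → GaugeField (F.P Ts) 0 ↥(Matrix.specialUnitaryGroup (Fin 2) ℂ))
    (J : GaugeField (F.P j) 0 ↥(Matrix.specialUnitaryGroup (Fin 2) ℂ) × Z → ℝ≥0) :
    ∀ (t : ℝ) (V : GaugeField (F.P j) 0 ↥(Matrix.specialUnitaryGroup (Fin 2) ℂ)) (z : Z), 0 ≤ wgt F γ b₀ p₀ j Ts ρ ρ' τ Φ J t V z := by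
  intro t V z
  have hN := wNum_nonneg F γ b₀ p₀ j Ts hjTs ρ ρ' hρpos hθ hχ0 hχsupp Φ J t V
  exact div_nonneg (hN z) (integral_nonneg fun z' => hN z')

end Summit.QuantumFields.YangMills.Theorems.OrganTangentFibreWeightNormalisation

end
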